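import Summits.AtomisticToContinuum.BoseEinsteinCondensation.Theorems.BoxLatticeFSumCarving
import Summits.AtomisticToContinuum.BoseEinsteinCondensation.Theorems.BoxLatticeFSumDCTOrthogonality
import HarnessLib

/-!
# DCT-II Plancherel for the box block span (kernel of MC = `BoxShellModeCounting`)  (decomp-a2c · hand-1 g9)

The coefficient-level identities behind «DCT Parseval `Σ_q n(g_q) = Σ_B n(u_B)`» of the `BoxLatticeFSum`
carving (`…Theorems.BoxLatticeFSumCarving`, lens-6 g29), from the Theses-free orthonormality
`BoxLatticeFSumDCT.dct3_orthonormal`: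

* `sum_dctCoeff_mul_dctCoeff` — `Σ_q dctCoeff K q B · dctCoeff K q B' = δ_{BB'}` (columns orthonormal);
* `dct_plancherel` — `Σ_q ‖Σ_B dctCoeff K q B · m_B‖² = Σ_B ‖m_B‖²` for every `m : SubIdx K → ℂ`
  (the analogue of the tree's `Plancherel.plancherel` for the torus characters, with constant `1`
  instead of `K³` because `dctCoeff` is already normalised).

No definitions, no `sorry`. [folklore]
-/

noncomputable section

open Finset
open scoped BigOperators ComplexConjugate

namespace Summit.AtomisticToContinuum.BoseEinsteinCondensation.Theorems.BoxLatticeFSum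

open Literature.MathematicalPhysics.QuantumManyBody.BoseGas

/-- **DCT-II columns are orthonormal**: `Σ_q dctCoeff K q B · dctCoeff K q B' = δ_{BB'}`. [folklore] -/
theorem sum_dctCoeff_mul_dctCoeff {K : ℕ} (hK : 0 < K) (B B' : SubIdx K) :
    ∑ q : SubIdx K, dctCoeff K q B * dctCoeff K q B' = if B = B' then 1 else 0 := by
  unfold dctCoeff
  exact BoxLatticeFSumDCT.dct3_orthonormal hK B B'

/-- **DCT-II Plancherel** on coefficient vectors: `Σ_q ‖Σ_B dctCoeff K q B · m_B‖² = Σ_B ‖m_B‖²`.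
[folklore] -/
theorem dct_plancherel {K : ℕ} (hK : 0 < K) (m : SubIdx K → ℂ) :
    ∑ q : SubIdx K, ‖∑ B : SubIdx K, ((dctCoeff K q B : ℝ) : ℂ) * m B‖ ^ 2 =
      ∑ B : SubIdx K, ‖m B‖ ^ 2 := by
  classical
  have hsq : ∀ z : ℂ, ((‖z‖ : ℂ)) ^ 2 = conj z * z := fun z => (Complex.conj_mul' z).symm
  have hd : ∀ q B : SubIdx K, conj (((dctCoeff K q B : ℝ) : ℂ)) = ((dctCoeff K q B : ℝ) : ℂ) :=
    fun q B => Complex.conj_ofReal _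
  have main : ∑ q : SubIdx K, conj (∑ B : SubIdx K, ((dctCoeff K q B : ℝ) : ℂ) * m B) *
        (∑ B : SubIdx K, ((dctCoeff K q B : ℝ) : ℂ) * m B)
      = ∑ B : SubIdx K, conj (m B) * m B := by
    calc ∑ q : SubIdx K, conj (∑ B : SubIdx K, ((dctCoeff K q B : ℝ) : ℂ) * m B) *
          (∑ B : SubIdx K, ((dctCoeff K q B : ℝ) : ℂ) * m B)
        = ∑ q : SubIdx K, ∑ B : SubIdx K, ∑ B' : SubIdx K,
            conj (m B) * m B' * (((dctCoeff K q B : ℝ) : ℂ) * ((dctCoeff K q B' : ℝ) : ℂ)) := by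
          refine Finset.sum_congr rfl fun q _ => ?_
          rw [map_sum, Finset.sum_mul]
          refine Finset.sum_congr rfl fun B _ => ?_
          rw [map_mul, hd, Finset.mul_sum]
          refine Finset.sum_congr rfl fun B' _ => ?_
          ring
      _ = ∑ B : SubIdx K, ∑ B' : SubIdx K, conj (m B) * m B' *
            ∑ q : SubIdx K, (((dctCoeff K q B : ℝ) : ℂ) * ((dctCoeff K q B' : ℝ) : ℂ)) := by
          rw [Finset.sum_comm]
          refine Finset.sum_congr rfl fun B _ => ?_
          rw [Finset.sum_comm]
          refine Finset.sum_congr rfl fun B' _ => ?_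
          rw [Finset.mul_sum]
      _ = ∑ B : SubIdx K, ∑ B' : SubIdx K, conj (m B) * m B' * (if B = B' then (1 : ℂ) else 0) := by
          refine Finset.sum_congr rfl fun B _ => Finset.sum_congr rfl fun B' _ => ?_
          congr 1
          have h := sum_dctCoeff_mul_dctCoeff hK B B'
          have h' : ∑ q : SubIdx K, (((dctCoeff K q B : ℝ) : ℂ) * ((dctCoeff K q B' : ℝ) : ℂ)) =
              (((∑ q : SubIdx K, dctCoeff K q B * dctCoeff K q B' : ℝ)) : ℂ) := by
            push_cast; rfl
          rw [h', h]
          split_ifs <;> simp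
      _ = ∑ B : SubIdx K, conj (m B) * m B := by
          refine Finset.sum_congr rfl fun B _ => ?_
          simp_rw [mul_ite, mul_one, mul_zero]
          rw [Finset.sum_ite_eq]
          simp
  apply Complex.ofReal_injective
  rw [Complex.ofReal_sum, Complex.ofReal_sum]
  simp_rw [Complex.ofReal_pow, hsq]
  exact main

end Summit.AtomisticToContinuum.BoseEinsteinCondensation.Theorems.BoxLatticeFSum

end
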